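import Literature.AlgebraicGeometry.Frobenioids.BiratUnitsTransport
import Literature.AlgebraicGeometry.Frobenioids.BirationalizationRigidity
import HarnessLib

/-!
# Frobenioids I, Proposition 1.11 (iv) / 2.2 (ii) for `C^birat`: the transport of `O^×(A^birat)` along a
# linear morphism is INJECTIVE

Mochizuki, *The geometry of Frobenioids I: the general theory*, Kyushu J. Math. **62** (2008) 293–400,
§1 Prop. 1.11 (iv) p. 36 ("Every co-angular linear morphism `φ : B → A` determines an *injection* of monoids
`O^▷(A) ↪ O^▷(B)` … uniquely determined by … `α ∘ φ = φ ∘ β`"), §2 Prop. 2.2 (ii) p. 45, §4 Prop. 4.4 (ii)(iv)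
p. 83 [cite: MochizukiFrdI2008, Prop. 1.11(iv) p.36]. In `C^birat` (a Frobenioid of group-like type,
Prop. 4.4 (ii)) `O^▷ = O^×` and the image of a co-angular linear morphism is a pull-back morphism
(Prop. 4.4 (iv)); abc-iut-L6-t8's `BiratUnits.transportHom ψ : O^×(A'^birat) →* O^×(A^birat)`
(`BiratUnitsTransport.lean`) is the resulting transport along a linear `ψ : A → A'` of a Frobenioid of
isotropic type. This file proves the word "injection": `transportHom ψ` is injective — two units with the
same transport agree after composing with the epimorphism `ψ^birat` (`Birat.epi_toBirat_map`, `C^birat` being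
totally epimorphic) — which is the content cited by [IUTchI] Rmk. 3.2.3 (ii) ("`ψ` induces an injective
homomorphism `O^×(T_A^birat) ↪ O^×(B^birat)` [cf. [FrdI], Proposition 1.11, (iv)]"). Interface hand-off by the
Prop. 1.11 owner (abc-iut-L1-t1). No statement of the paper is strengthened.
-/

namespace Literature.AlgebraicGeometry.Frobenioids

open CategoryTheory Opposite

universe w v v' u u'

namespace PreFrobenioid

namespace BiratUnits

variable {D : Type u} [Category.{v} D] {Φ : Dᵒᵖ ⥤ CommMonCat.{w}}
  {C : Type u'} [Category.{v'} C] {F : C ⥤ ElemFrobenioid Φ} {hF : IsFrobenioid F}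
  {hsq : HasBiratSquares F} {A A' : C}

/-- Two units of `A'^birat` intertwined along `ψ` with the same unit of `A^birat` coincide
(`ψ ∘ u = v ∘ ψ = v' ∘ ψ` and `ψ^birat` is an epimorphism of `C^birat`).
[cite: MochizukiFrdI2008, Prop. 1.11(iv) p.36] -/
theorem eq_of_intertwines_left (hsq : HasBiratSquares F) {ψ : A ⟶ A'} {u : BiratUnits F hF A}
    {v v' : BiratUnits F hF A'} (h : Intertwines hF ψ u v) (h' : Intertwines hF ψ u v') : v = v' := by
  rw [intertwines_iff_toHom_comm hsq] at h h'
  haveI := Birat.epi_toBirat_map hF hsq ψ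
  exact toHom_injective (cancel_epi ((toBirat F hF hsq).map ψ) |>.mp (h.symm.trans h'))

/-- **Prop. 1.11 (iv) for `C^birat`, "injection"**: along a linear morphism `ψ : A → A'` of a Frobenioid of
isotropic type, the transport `O^×(A'^birat) → O^×(A^birat)`, `v ↦` the unique `u` with `ψ ∘ u = v ∘ ψ`, is
INJECTIVE. [cite: MochizukiFrdI2008, Prop. 1.11(iv) p.36] -/
theorem transportHom_injective (hiso : IsOfIsotropicType F) (ψ : A ⟶ A') (hψ : IsLinear F ψ) :
    Function.Injective (transportHom hF hsq hiso ψ hψ) := fun v v' h =>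
  eq_of_intertwines_left hsq (intertwines_transportHom hiso ψ hψ v)
    (h ▸ intertwines_transportHom hiso ψ hψ v')

/-- The same along a PULL-BACK morphism, for abc-iut-L6-t8's `pullbackHom` (Prop. 1.11 (iv) / 2.2 (ii)(a)).
[cite: MochizukiFrdI2008, Prop. 1.11(iv) p.36] -/
theorem pullbackHom_injective (hiso : IsOfIsotropicType F) (ψ : A ⟶ A') (hψ : IsPullbackMorphism F ψ) :
    Function.Injective (pullbackHom hF hsq hiso ψ hψ) := fun v v' h =>
  eq_of_intertwines_left hsq (intertwines_pullbackHom hiso ψ hψ v)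
    (h ▸ intertwines_pullbackHom hiso ψ hψ v')

end BiratUnits

end PreFrobenioid

end Literature.AlgebraicGeometry.Frobenioids
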